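import Summits.CriticalPhenomena.Ising3DConformalLimit.Theses.MonotoneBlocking
import HarnessLib

/-!
# Sketch — crux idea `karlin-scale-tp2` for `MonotoneBlockingTwo` (item stmt-CriticalPhenomena-17054)

First-lemma signatures of the idea card `Ideas/karlin-scale-tp2.md` (crux-ideate round 1, ideator 1).
Nothing here is proposed to the tree.  The lever: Karlin's basic composition formula (total positivity
is closed under composition) + Holley/FKG folding, applied to the continuum embedding
`bc(L,k) = L⁶ ∫ Γ(L w) T(w - k) dw` of the block covariance (`T` = unit tent), gives BM₂ — indeed
TP₂ of `bc` in (block side, coordinatewise |offset|) — for every kernel in the SCALE-TOTAL-POSITIVITY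
class `KarlinClass` below, plus a non-negative on-site nugget.  The transferred crux is the
representability statement `CriticalKarlinRepresentable`.
-/

noncomputable section

namespace Summit.CriticalPhenomena.Ising3DConformalLimit.Cruxes.MonotoneBlockingTwo.KarlinScaleTP2

open MeasureTheory Finset
open scoped BigOperators
open Literature.Probability.LatticeModels
open Summit.CriticalPhenomena.Ising3DConformalLimit.Theses.MonotoneBlocking (MonotoneBlockingTwo)

/-! ## §0 The BM₂ shape of an arbitrary kernel (route's let-bound `cube`, `bc`, verbatim) -/

/-- The route's cube `[0,L)³ ∩ ℤ³`. -/
def cube (L : ℕ) : Finset (Site 3) := Fintype.piFinset fun _ : Fin 3 => Finset.Ico (0:ℤ) (L:ℤ)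

/-- Block covariance functional `bc_G(L,k) = Σ_{x,y ∈ cube L} G(L•k + x − y)`. -/
def bcK (G : Site 3 → ℝ) (L : ℕ) (k : Site 3) : ℝ :=
  ∑ x ∈ cube L, ∑ y ∈ cube L, G ((L:ℤ) • k + x - y)

/-- BM₂ shape for a kernel `G`: `ρ_G(L;k) = bc(L,k)/bc(L,0)` non-decreasing in `L ≥ 1`, cross-multiplied. -/
def BM2Shape (G : Site 3 → ℝ) : Prop :=
  ∀ L : ℕ, 1 ≤ L → ∀ k : Site 3, bcK G L k * bcK G (L+1) 0 ≤ bcK G (L+1) k * bcK G L 0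

/-- The crux IS the BM₂ shape of the critical two-point function (definitional). -/
theorem monotoneBlockingTwo_iff : MonotoneBlockingTwo ↔ BM2Shape (criticalTwoPoint 3) := Iff.rfl

/-! ## §1 Continuum embedding: cell-smearing -/

/-- Cell-smearing of a continuum kernel `Γ : ℝ³ → ℝ` onto the lattice:
`(Γ ⋆ T)(z) = ∫_{[0,1]³}∫_{[0,1]³} Γ(z + u − v) du dv` (`T` = unit tent `Π (1-|wᵢ|)₊`). -/
def cellSmear (Γ : (Fin 3 → ℝ) → ℝ) (z : Site 3) : ℝ :=
  ∫ u in Set.Icc (0 : Fin 3 → ℝ) 1, ∫ v in Set.Icc (0 : Fin 3 → ℝ) 1,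
    Γ (fun i => (z i : ℝ) + u i - v i)

/-- Coordinatewise magnitudes `|y| := (|y₀|,|y₁|,|y₂|)`. -/
def absv (y : Fin 3 → ℝ) : Fin 3 → ℝ := fun i => |y i|

/-- **The scale-total-positivity class 𝒦** (Karlin class) of continuum kernels `Γ : ℝ³ → ℝ`:
(pos) `Γ > 0`; (even) invariance under each coordinate reflection (so `bc` depends on `|kᵢ|`);
(mtp2) `Γ ∘ |·|` is multivariate-TP₂ (log-supermodular) in the magnitudes — Holley's criterion for the
transversal measures; (scale) for `λ ≥ 1` the dilation ratio `Γ(λy)/Γ(y)` is non-decreasing in the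
magnitudes coordinatewise — "local scaling exponent non-increasing", the negation of scale intermittency;
(cubic) `r³ Γ(r ŷ)` non-decreasing along rays (decay no faster than `|y|⁻³`, for the nugget);
(int) local integrability incl. at the origin.  Exact power laws `|y|^{-a} Ω(ŷ)`, `a ≤ 3`, with
`log Ω` having log-Hessian off-diagonal defect ≤ `2a ŷᵢ²ŷⱼ²`, are members; `|y|^{-a}(1 + d|y|^{-ω})` is a
member iff `d ≥ 0`. -/
structure KarlinClass (Γ : (Fin 3 → ℝ) → ℝ) : Prop where
  pos : ∀ y, y ≠ 0 → 0 < Γ y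
  even : ∀ y (i : Fin 3), Γ (Function.update y i (-(y i))) = Γ y
  mtp2 : ∀ y y' : Fin 3 → ℝ, (∀ i, 0 ≤ y i) → (∀ i, 0 ≤ y' i) →
    Γ y * Γ y' ≤ Γ (y ⊔ y') * Γ (y ⊓ y')
  scale : ∀ lam : ℝ, 1 ≤ lam → ∀ y y' : Fin 3 → ℝ, y ≠ 0 → (∀ i, |y i| ≤ |y' i|) →
    Γ (lam • y) * Γ y' ≤ Γ (lam • y') * Γ y
  cubic : ∀ lam : ℝ, 1 ≤ lam → ∀ y : Fin 3 → ℝ, y ≠ 0 → Γ y ≤ lam ^ 3 * Γ (lam • y)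
  int : LocallyIntegrable Γ volume ∧ IntegrableOn Γ (Metric.closedBall 0 4) volume

/-! ## §2 First lemma (the provable stub): Karlin composition ⟹ BM₂ for the whole class -/

/-- **KarlinComposition** (real analysis; the line's provable stub).  For `Γ ∈ 𝒦` and a nugget
`N ≥ 0`, the lattice kernel `z ↦ (Γ⋆T)(z) + N·𝟙_{z=0}` has the BM₂ shape (all `L ≥ 1`, all `k`).
Proof route: `bc = L⁶∫Γ(Lw)T(w-k)dw` exactly (cell-smearing ∘ block sum = block integral); fold each
coordinate to `w ≥ 0` (the folded unit tent `T(w-n)+T(w+n)` is TP₂ on `ℝ₊ × ℕ` because tent width =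
block spacing); basic composition formula in coordinate 1 with the transversally smeared profile
`Φ_L(w)`, whose TP₂ in `(L,w)` follows from (scale) + (mtp2) via Holley; chain over the three
coordinates; the nugget column needs only (cubic). -/
def KarlinComposition : Prop :=
  ∀ (Γ : (Fin 3 → ℝ) → ℝ) (N : ℝ), KarlinClass Γ → 0 ≤ N →
    BM2Shape (fun z => cellSmear Γ z + if z = 0 then N else 0)

/-- The stronger conclusion actually delivered by the composition argument (testable prediction:
`ρ(L;k')/ρ(L;k)` non-decreasing in `L` whenever `|k'ᵢ| ≥ |kᵢ|` for all `i`): TP₂ of `bc` in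
(block side, coordinatewise offset magnitude). -/
def BlockTP2 (G : Site 3 → ℝ) : Prop :=
  ∀ L L' : ℕ, 1 ≤ L → L ≤ L' → ∀ k k' : Site 3, (∀ i, |k i| ≤ |k' i|) →
    bcK G L k' * bcK G L' k ≤ bcK G L k * bcK G L' k'

def KarlinCompositionTP2 : Prop :=
  ∀ (Γ : (Fin 3 → ℝ) → ℝ) (N : ℝ), KarlinClass Γ → 0 ≤ N →
    BlockTP2 (fun z => cellSmear Γ z + if z = 0 then N else 0)

/-- BlockTP2 contains the BM₂ shape (column `k = 0`). -/
theorem bm2Shape_of_blockTP2 (G : Site 3 → ℝ) (h : BlockTP2 G) : BM2Shape G := by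
  intro L hL k
  have := h L (L+1) hL (Nat.le_succ L) 0 k (fun i => by simp)
  linarith [this]

/-! ## §3 The transferred crux C⁺: scale-total-positive representability of the critical two-point function -/

/-- **C⁺ (KarlinRepresentable)**: the critical nearest-neighbour two-point function on `ℤ³` is the
cell-smearing of a kernel in the Karlin class plus a non-negative on-site nugget.  Contains the
infrared bit (sign `d ≥ 0` of the leading correction to scaling, as (scale) at large `|y|`) and a UV
feasibility statement (radial sub-class REFUTED at `|z| ≤ 2` by the certificate in the card; the
anisotropic class with positive discrete UV atoms is the live form, see `KarlinRepresentableUV`). -/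
def CriticalKarlinRepresentable : Prop :=
  ∃ (Γ : (Fin 3 → ℝ) → ℝ) (N : ℝ), KarlinClass Γ ∧ 0 ≤ N ∧
    ∀ z : Site 3, criticalTwoPoint 3 z = cellSmear Γ z + if z = 0 then N else 0

/-- Variant with a finitely supported non-negative discrete UV remainder `ν` (site + bond nuggets …):
each atom perturbs finitely many columns of `bc` by explicit polynomials in `L`; asymptotically harmless
under (cubic).  The composition stub for this variant carries a finite list of small-`L` side conditions. -/
def CriticalKarlinRepresentableUV : Prop :=
  ∃ (Γ : (Fin 3 → ℝ) → ℝ) (ν : Site 3 → ℝ) (R : ℕ), KarlinClass Γ ∧ (∀ z, 0 ≤ ν z) ∧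
    (∀ z : Site 3, (∃ i, (R : ℤ) < |z i|) → ν z = 0) ∧
    ∀ z : Site 3, criticalTwoPoint 3 z = cellSmear Γ z + ν z

/-- **The line, kernel-checked modus ponens**: composition stub + representability ⟹ the crux, by name. -/
theorem monotoneBlockingTwo_of_karlin (h₁ : KarlinComposition) (h₂ : CriticalKarlinRepresentable) :
    MonotoneBlockingTwo := by
  obtain ⟨Γ, N, hK, hN, hG⟩ := h₂
  have hfun : criticalTwoPoint 3 = fun z => cellSmear Γ z + if z = 0 then N else 0 := funext hG
  rw [monotoneBlockingTwo_iff, hfun]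
  exact h₁ Γ N hK hN

/-! ## §4 Sanity: exact members of the class (statements used by the card; not proved here) -/

/-- The pure power law is scale-TP₂ with equality and MTP₂ in magnitudes (`∂ᵢ∂ⱼ log = 2a ŷᵢ²ŷⱼ²/… ≥ 0`). -/
def powerLawMember : Prop :=
  ∀ a : ℝ, 0 < a → a ≤ 3 → KarlinClass (fun y : Fin 3 → ℝ => (∑ i, (y i) ^ 2) ^ (-(a / 2)))

/-- The Wegner-corrected power law `|y|^{-a}(1 + d |y|^{-ω})` is in the class iff `d ≥ 0`
(for `0 < ω`, `a + ω ≤ 3`): the infrared bit of BM₂, isolated as a property of the correction FACTOR. -/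
def wegnerMember_iff : Prop :=
  ∀ a ω d : ℝ, 0 < a → 0 < ω → a + ω ≤ 3 → -1 < d →
    (KarlinClass (fun y : Fin 3 → ℝ =>
      (∑ i, (y i) ^ 2) ^ (-(a / 2)) * (1 + d * (∑ i, (y i) ^ 2) ^ (-(ω / 2)))) ↔ 0 ≤ d)

end Summit.CriticalPhenomena.Ising3DConformalLimit.Cruxes.MonotoneBlockingTwo.KarlinScaleTP2

end
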